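import Summits.ResolutionOfSingularities.ResolutionOfSingularities.Theorems.RadicialJungCleanModelsSufficeChartsMonoid
import Mathlib.Algebra.BigOperators.Associated
import Mathlib.RingTheory.LocalRing.MaximalIdeal.Basic
import Mathlib.Data.Int.ModEq

/-!
# Route `RadicialJung`, crux `CleanModelsSuffice`, line `Sketch`: compatibility of two Kummer
# charts at a common point (exponent arithmetic)

Helper for the registered stub `stub_charts` of the skeleton of
`Summit.ResolutionOfSingularities.ResolutionOfSingularities.Theses.RadicialJung.CleanModelsSuffice`
(stmt-ResolutionOfSingularities-15883). Two toroidal charts of the adapted clean model meet at a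
point `w`; in the local ring `A = 𝒪_{V,w}` their boundary parameters `t¹_i`, `t²_{i'}` that are
NOT units come in associated pairs `t¹_i ~ t²_{σ i}` (a bijection `σ : S₁ ≃ S₂` with inverse `τ`
between the non-unit indices), and the exponents are proportional modulo `p`:
`a¹_i ≡ μ a²_{σ i} (mod p)`, with `a²_0 = 1`. This file proves the purely arithmetical heart of
the compatibility of the two Kato charts: for every `c` in the Kummer monoid `P_{a¹}` there is
`c'` in `P_{a²}` whose weight monomial `∏ (t²_{i'})^{w_{i'}(c')}` is ASSOCIATED in `A` to
`∏ (t¹_i)^{w_i(c)}` — indeed `c'` is solved for from `w²_{σ i}(c') = w¹_i(c)` (`i ∈ S₁`), which is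
possible exactly because of the congruences. Since the `p`-th power of a chart value is its weight
monomial (`RadicialJungCleanModelsSufficeChartsKummer.lean`), the two chart values then differ by
a unit of the integral closure.
-/

set_option linter.dupNamespace false -- mandated namespace of this single-conjunct summit

namespace Summit.ResolutionOfSingularities.ResolutionOfSingularities.Theorems.RadicialJung.CleanModelsSuffice

/-- **Matching the weights of two Kummer charts at a common point.** Let `A` be a local ring,
`(t¹, a¹)` and `(t², a²)` two Kummer data (`a²_0 = 1`), `S₁`, `S₂` the indices of the non-unit
parameters, `σ : S₁ → S₂` and `τ : S₂ → S₁` mutually inverse with `t¹_i ~ t²_{σ i}` and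
`a¹_i ≡ μ a²_{σ i} (mod p)` on `S₁`. Then for every `c ∈ P_{a¹}` there is `c' ∈ P_{a²}` with
`∏_i (t¹_i)^{w_i(c)} ~ ∏_{i'} (t²_{i'})^{w_{i'}(c')}` in `A`. [folklore] -/
theorem exists_associated_weightMonomial {A : Type*} [CommRing A] [IsLocalRing A] (p : ℕ)
    {m₁ m₂ : ℕ} (t₁ : Fin (m₁ + 1) → A) (a₁ : Fin (m₁ + 1) → ℕ)
    (t₂ : Fin (m₂ + 1) → A) (a₂ : Fin (m₂ + 1) → ℕ) (ha₂0 : a₂ 0 = 1)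
    (S₁ : Finset (Fin (m₁ + 1))) (hS₁ : ∀ i, i ∈ S₁ ↔ t₁ i ∈ IsLocalRing.maximalIdeal A)
    (S₂ : Finset (Fin (m₂ + 1))) (hS₂ : ∀ i, i ∈ S₂ ↔ t₂ i ∈ IsLocalRing.maximalIdeal A)
    (σ : Fin (m₁ + 1) → Fin (m₂ + 1)) (τ : Fin (m₂ + 1) → Fin (m₁ + 1)) (μ : ℕ)
    (hσ : ∀ i ∈ S₁, σ i ∈ S₂ ∧ τ (σ i) = i ∧ Associated (t₁ i) (t₂ (σ i)) ∧
      a₁ i ≡ μ * a₂ (σ i) [MOD p])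
    (hτ : ∀ i' ∈ S₂, τ i' ∈ S₁ ∧ σ (τ i') = i')
    (c : Fin (m₁ + 1) → ℤ) (hc : c ∈ kummerMonoid p a₁) :
    ∃ c' ∈ kummerMonoid p a₂,
      Associated (∏ i, t₁ i ^ (kummerWeight p a₁ c i).toNat)
        (∏ i', t₂ i' ^ (kummerWeight p a₂ c' i').toNat) := by
  classical
  set w₁ : Fin (m₁ + 1) → ℤ := kummerWeight p a₁ c with hw₁
  have hw₁0 : ∀ i, 0 ≤ w₁ i := kummerWeight_nonneg p a₁ hc
  -- the `0`-th coordinate of `c'`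
  set c₀' : ℤ := if (0 : Fin (m₂ + 1)) ∈ S₂ then w₁ (τ 0) else (μ : ℤ) * c 0 with hc₀'
  -- `w¹_i ≡ μ a²_{σ i} c₀ (mod p)` on `S₁`
  have hw₁mod : ∀ i ∈ S₁, w₁ i ≡ (μ : ℤ) * a₂ (σ i) * c 0 [ZMOD p] := by
    intro i hi
    have h1 : w₁ i ≡ (a₁ i : ℤ) * c 0 [ZMOD p] := kummerWeight_modEq p a₁ c i
    have h2 : ((a₁ i : ℕ) : ℤ) ≡ ((μ * a₂ (σ i) : ℕ) : ℤ) [ZMOD p] :=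
      Int.natCast_modEq_iff.mpr (hσ i hi).2.2.2
    have h3 := h2.mul_right (c 0)
    push_cast at h3
    exact h1.trans h3
  have hc₀'mod : c₀' ≡ (μ : ℤ) * c 0 [ZMOD p] := by
    by_cases h0 : (0 : Fin (m₂ + 1)) ∈ S₂
    · rw [hc₀', if_pos h0]
      obtain ⟨hτ0, hστ0⟩ := hτ 0 h0
      have h := hw₁mod (τ 0) hτ0
      rw [hστ0, ha₂0, Nat.cast_one, mul_one] at h
      exact h
    · rw [hc₀', if_neg h0]
  have hc₀'nonneg : 0 ≤ c₀' := by
    by_cases h0 : (0 : Fin (m₂ + 1)) ∈ S₂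
    · rw [hc₀', if_pos h0]; exact hw₁0 _
    · rw [hc₀', if_neg h0]; exact mul_nonneg (by positivity) hc.1
  -- divisibility on `S₂`
  have hdvd : ∀ i' ∈ S₂, (p : ℤ) ∣ w₁ (τ i') - (a₂ i' : ℤ) * c₀' := by
    intro i' hi'
    obtain ⟨hτi, hστ⟩ := hτ i' hi'
    have h1 := hw₁mod (τ i') hτi
    rw [hστ] at h1
    have h2 : (a₂ i' : ℤ) * c₀' ≡ (a₂ i' : ℤ) * ((μ : ℤ) * c 0) [ZMOD p] := hc₀'mod.mul_left _
    have h3 : (a₂ i' : ℤ) * c₀' ≡ w₁ (τ i') [ZMOD p] := by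
      refine h2.trans ?_
      rw [show (a₂ i' : ℤ) * ((μ : ℤ) * c 0) = (μ : ℤ) * a₂ i' * c 0 by ring]
      exact h1.symm
    exact h3.dvd
  -- the exponent vector `c'`
  let c' : Fin (m₂ + 1) → ℤ := fun i' =>
    if i' = 0 then c₀' else if i' ∈ S₂ then (w₁ (τ i') - (a₂ i' : ℤ) * c₀') / p else 0
  have hc'0 : c' 0 = c₀' := if_pos rfl
  have hw₂S : ∀ i' ∈ S₂, kummerWeight p a₂ c' i' = w₁ (τ i') := by
    intro i' hi'
    by_cases h0 : i' = 0
    · subst h0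
      rw [kummerWeight_zero_index_of_eq_one p a₂ ha₂0, hc'0, hc₀', if_pos hi']
    · rw [kummerWeight_of_ne_zero p a₂ c' h0, hc'0]
      simp only [c', if_neg h0, if_pos hi']
      rw [Int.mul_ediv_cancel' (hdvd i' hi')]
      ring
  have hw₂out : ∀ i', i' ∉ S₂ → i' ≠ 0 → kummerWeight p a₂ c' i' = (a₂ i' : ℤ) * c₀' := by
    intro i' hi' h0
    rw [kummerWeight_of_ne_zero p a₂ c' h0, hc'0]
    simp [c', h0, hi']
  have hc'mem : c' ∈ kummerMonoid p a₂ := by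
    refine mem_kummerMonoid_of_kummerWeight_nonneg p a₂ (by rw [hc'0]; exact hc₀'nonneg)
      fun i' h0 => ?_
    by_cases hi' : i' ∈ S₂
    · rw [hw₂S i' hi']; exact hw₁0 _
    · rw [hw₂out i' hi' h0]; exact mul_nonneg (by positivity) hc₀'nonneg
  refine ⟨c', hc'mem, ?_⟩
  -- compare in the monoid of associates
  have hu₁ : ∀ i, i ∉ S₁ → Associates.mk (t₁ i ^ (w₁ i).toNat) = 1 := fun i hi => by
    rw [Associates.mk_eq_one]
    exact (IsLocalRing.notMem_maximalIdeal.mp fun h => hi ((hS₁ i).mpr h)).pow _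
  have hu₂ : ∀ i', i' ∉ S₂ → Associates.mk (t₂ i' ^ (kummerWeight p a₂ c' i').toNat) = 1 :=
    fun i' hi' => by
    rw [Associates.mk_eq_one]
    exact (IsLocalRing.notMem_maximalIdeal.mp fun h => hi' ((hS₂ i').mpr h)).pow _
  rw [← Associates.mk_eq_mk_iff_associated, ← Associates.finsetProd_mk, ← Associates.finsetProd_mk,
    ← Finset.prod_mul_prod_compl S₁, ← Finset.prod_mul_prod_compl S₂,
    Finset.prod_eq_one (s := S₁ᶜ) (fun i hi => hu₁ i (Finset.mem_compl.mp hi)),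
    Finset.prod_eq_one (s := S₂ᶜ) (fun i' hi' => hu₂ i' (Finset.mem_compl.mp hi')), mul_one, mul_one]
  -- `∏_{S₁} [t¹_i]^{w_i} = ∏_{S₁} [t²_{σ i}]^{w_i} = ∏_{S₂} [t²_{i'}]^{w_{τ i'}}`
  have h1 : ∏ i ∈ S₁, Associates.mk (t₁ i ^ (w₁ i).toNat) =
      ∏ i ∈ S₁, Associates.mk (t₂ (σ i)) ^ (w₁ i).toNat := by
    refine Finset.prod_congr rfl fun i hi => ?_
    rw [Associates.mk_pow, Associates.mk_eq_mk_iff_associated.mpr (hσ i hi).2.2.1]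
  have h2 : ∏ i' ∈ S₂, Associates.mk (t₂ i' ^ (kummerWeight p a₂ c' i').toNat) =
      ∏ i' ∈ S₂, Associates.mk (t₂ (σ (τ i'))) ^ (w₁ (τ i')).toNat := by
    refine Finset.prod_congr rfl fun i' hi' => ?_
    rw [Associates.mk_pow, hw₂S i' hi', (hτ i' hi').2]
  rw [h1, h2]
  symm
  exact Finset.prod_nbij' τ σ (fun i' hi' => (hτ i' hi').1) (fun i hi => (hσ i hi).1)
    (fun i' hi' => (hτ i' hi').2) (fun i hi => (hσ i hi).2.1) (fun i' _ => rfl)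

end Summit.ResolutionOfSingularities.ResolutionOfSingularities.Theorems.RadicialJung.CleanModelsSuffice
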